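import Summits.HodgeConjecture.CorCM.CycleClassFacts
import Literature.AlgebraicGeometry.HodgeTheory.GysinBaseChange
import Literature.AlgebraicGeometry.HodgeTheory.HodgeRiemannPolarizabilityProofs
import Literature.AlgebraicGeometry.HodgeTheory.ComplexGysin
import HarnessLib

/-!
# COR-CM model layer, part 6b (towards fact F7 `Fact_gysin`): the top class of a product is the cup product
# of the pulled-back top classes of the factors

Cell `pub-hodgecm2` (COR-CM), seat `model-1`; the binary «Künneth top-class» step KT2 of the plan for row Fg7
(HOME seat `FG7-GYSIN-PLAN.md`): for smooth projective `Y`, `Z` of dimensions `m`, `n` and NON-ZERO top classes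
`y ∈ H^{2m}(Y(ℂ))`, `z ∈ H^{2n}(Z(ℂ))`, the class `fst^* y ∪ snd^* z ∈ H^{2(m+n)}((Y ⊗ Z)(ℂ))` is non-zero (hence
spans the top line).  Proof from the tree's Künneth spanning theorem `kunnethSpan_complexBetti` (Hatcher Thm. 3.15):
every cross product `fst^* b ∪ snd^* w` of total degree `2(m+n)` is a multiple of `fst^* y ∪ snd^* z` (degrees above
the top vanish, `subsingleton_complexBetti`; the top cohomology of `Y`, `Z` is a line, `finrank_complexBetti_two_mul_eq_one`),
and `H^{2(m+n)}((Y ⊗ Z)(ℂ)) ≠ 0`.  Complex and rational forms.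
-/

noncomputable section

open CategoryTheory MonoidalCategory CartesianMonoidalCategory
open Literature.AlgebraicTopology.SingularHomology
open Literature.AlgebraicGeometry.Motives (SchemeOver ComplexPoints IsSmoothProjective bettiCohomology)
open Literature.AlgebraicGeometry.HodgeTheory

namespace Summit.HodgeConjecture.CorCM.Model

variable {m n : ℕ} {Y Z : SchemeOver ℂ}

/-- In a line, every vector is a multiple of a given non-zero vector. -/
theorem exists_smul_eq_of_finrank_eq_one {K V : Type*} [Field K] [AddCommGroup V] [Module K V]
    (h1 : Module.finrank K V = 1) {v : V} (hv : v ≠ 0) (w : V) : ∃ c : K, c • v = w :=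
  (finrank_eq_one_iff_of_nonzero' v hv).1 h1 w

/-- **The top class of `Y ⊗ Z` is `fst^* y ∪ snd^* z`** (complex coefficients): for non-zero top classes `y`, `z`
of smooth projective `Y`, `Z`, `fst^* y ∪ snd^* z ≠ 0` in `H^{2(m+n)}((Y ⊗ Z)(ℂ); ℂ)`. -/
theorem cupProduct_map_fst_map_snd_top_ne_zero (hY : IsSmoothProjective m Y) (hZ : IsSmoothProjective n Z)
    {y : complexBetti Y (2 * m)} (hy : y ≠ 0) {z : complexBetti Z (2 * n)} (hz : z ≠ 0) :
    cupProduct (two_mul_add_two_mul m n) (complexBetti.map (fst Y Z) (2 * m) y)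
      (complexBetti.map (snd Y Z) (2 * n) z) ≠ 0 := by
  set G := cupProduct (two_mul_add_two_mul m n) (complexBetti.map (fst Y Z) (2 * m) y)
    (complexBetti.map (snd Y Z) (2 * n) z) with hG
  -- every cross product of top total degree is a multiple of `G`
  have hgen : ∀ v ∈ {v | ∃ (i j : ℕ) (h : i + j = 2 * (m + n)) (b : complexBetti Y i) (w : complexBetti Z j),
      v = cupProduct h (complexBetti.map (fst Y Z) i b) (complexBetti.map (snd Y Z) j w)},
      v ∈ Submodule.span ℂ {G} := by
    rintro v ⟨i, j, h, b, w, rfl⟩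
    by_cases hi : 2 * m < i
    · haveI := subsingleton_complexBetti hY hi
      rw [Subsingleton.elim b 0, map_zero, LinearMap.map_zero₂]
      exact Submodule.zero_mem _
    by_cases hj : 2 * n < j
    · haveI := subsingleton_complexBetti hZ hj
      rw [Subsingleton.elim w 0, map_zero, map_zero]
      exact Submodule.zero_mem _
    obtain rfl : i = 2 * m := by omega
    obtain rfl : j = 2 * n := by omega
    obtain ⟨α, rfl⟩ := exists_smul_eq_of_finrank_eq_one (finrank_complexBetti_two_mul_eq_one hY) hy b
    obtain ⟨β, rfl⟩ := exists_smul_eq_of_finrank_eq_one (finrank_complexBetti_two_mul_eq_one hZ) hz w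
    simp only [map_smul, LinearMap.smul_apply, smul_smul]
    exact Submodule.smul_mem _ _ (Submodule.mem_span_singleton_self G)
  -- hence the top cohomology of `Y ⊗ Z` lies in the span of `G`; it is non-zero, so `G ≠ 0`
  intro hG0
  haveI := finite_complexBetti (Literature.AlgebraicGeometry.Motives.IsSmoothProjective.tensor_holds hY hZ) (2 * (m + n))
  obtain ⟨v, hv⟩ := Module.finrank_pos_iff_exists_ne_zero.1
    (by rw [finrank_complexBetti_two_mul_eq_one
      (Literature.AlgebraicGeometry.Motives.IsSmoothProjective.tensor_holds hY hZ)]; exact Nat.one_pos)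
  apply hv
  have hle : Submodule.span ℂ {v | ∃ (i j : ℕ) (h : i + j = 2 * (m + n)) (b : complexBetti Y i)
      (w : complexBetti Z j), v = cupProduct h (complexBetti.map (fst Y Z) i b)
        (complexBetti.map (snd Y Z) j w)} ≤ Submodule.span ℂ {G} :=
    Submodule.span_le.2 hgen
  have hvG := hle (kunnethSpan_complexBetti hY hZ (2 * (m + n)) v)
  rw [hG0, Submodule.span_singleton_eq_bot.2 rfl, Submodule.mem_bot] at hvG
  exact hvG

/-- Degree transport for the vanishing of a cup product. -/
theorem cupProduct_eq_zero_iff_of_eq {R : Type} [CommRing R] {T : Type} [TopologicalSpace T] {p q k l : ℕ}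
    (h₁ : p + q = k) (h₂ : p + q = l) (a : singularCohomology R R T p) (b : singularCohomology R R T q) :
    cupProduct h₁ a b = 0 ↔ cupProduct h₂ a b = 0 := by
  subst h₁; subst h₂; exact Iff.rfl

/-- **Rational form**: for non-zero top classes `y ∈ H^{2m}(Y(ℂ); ℚ)`, `z ∈ H^{2n}(Z(ℂ); ℚ)`, the rational class
`fst^* y ∪ snd^* z ∈ H^{2m+2n}((Y ⊗ Z)(ℂ); ℚ)` (the model's `BettiUniverse.cup/pull`) is non-zero. -/
theorem cup_pull_fst_pull_snd_top_ne_zero (hY : IsSmoothProjective m Y) (hZ : IsSmoothProjective n Z)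
    {y : bettiCohomology Y (2 * m)} (hy : y ≠ 0) {z : bettiCohomology Z (2 * n)} (hz : z ≠ 0) :
    BettiUniverse.cup (Y ⊗ Z) (2 * m) (2 * n) (BettiUniverse.pull (fst Y Z) (2 * m) y)
      (BettiUniverse.pull (snd Y Z) (2 * n) z) ≠ 0 := by
  intro h0
  have h1 := congrArg (ofRatClass (ComplexPoints (Y ⊗ Z)) (2 * m + 2 * n)) h0
  rw [map_zero, ofRatClass_cup, ofRatClass_pull, ofRatClass_pull] at h1
  have hy' : ofRatClass (ComplexPoints Y) (2 * m) y ≠ 0 := fun h ↦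
    hy (ofRatClass_injective (2 * m) (by rw [h, map_zero]))
  have hz' : ofRatClass (ComplexPoints Z) (2 * n) z ≠ 0 := fun h ↦
    hz (ofRatClass_injective (2 * n) (by rw [h, map_zero]))
  exact cupProduct_map_fst_map_snd_top_ne_zero hY hZ hy' hz'
    ((cupProduct_eq_zero_iff_of_eq rfl (two_mul_add_two_mul m n) _ _).1 h1)

end Summit.HodgeConjecture.CorCM.Model

end
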